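import Summits.BirchSwinnertonDyer.BirchSwinnertonDyer.Theorems.PrintX9MuPartStabilizedOfSpecWitnessesAlong
import Summits.BirchSwinnertonDyer.BirchSwinnertonDyer.Theorems.PrintX9HowardContainmentLightFramePinnedOfPrintSharpOfMuCoherentPair
import HarnessLib

/-!
# The deciding crux `PrintX9.HowardContainmentLightFramePinnedOfPrintSharp` (stmt-BirchSwinnertonDyer-27077) from
# specialisation witnesses ALONG AN INFINITE SET OF LEVELS — CONDITIONAL CLOSER (row 9)

Cell `pub/bsd-print-x9`, seat `bsd-line-x9-p1-w3` (g3, extra width on line `torsion-depth-pinned`, LEAD lineage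
`bsd-line-x9-p1`), `--supports` stmt-BirchSwinnertonDyer-27077. The registered skeleton v8 on 27077 has ONE stub,
the L∃ μ-letter `HeegnerMuPartStabilized.MuPartStabilizedCoherentPair` (p630902), composed with the LEAD's closer
`PrintX9SharpMuCoherentPair.howardContainmentLightFramePinnedOfPrintSharp_of_muPartStabilizedCoherentPair` (p631843).
This file records, BY NAME, that the WEAKER witness shell `HeegnerMuPartStabilized.SpecWitnessesCoherentPairAlong`
(`PrintX9MuPartSpecWitnessAlongDefs`: the road's exported coherent pair + `SpecWitness`es at INFINITELY MANY
Eisenstein primes `q_m = T^m + p` of the constructor's choosing, with an `m`-uniform constant) already gives the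
crux: `…Along ⟹ MuPartStabilizedCoherentPair` (`PrintX9MuPartStabilizedOfSpecWitnessesAlong`) `⟹ 27077` (p631843).

HONEST FRAMING: nothing here proves the shell; the crux 27077, its stub and BSD are exactly as open as before.
What changed: a D1 seat (carrier + m-uniform control + DVR Kolyvagin bound, beyond citable print at `p ∣ h_K`,
REF-118) may deliver witnesses along any infinite set of levels `m` and still close row 9 by name.
«beyond-print theorem»: no. BSD is not proved by any of this; no summit statement is proved by this seat.

References: [Howard2004HeegnerKolyvagin] proof of Thm. 2.2.10 (`𝔮 = T^m + p`, `m → ∞`); [MastellaZerman2026]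
Thm. 2.40; design of the witness interface and of the «along» weakening: bsd-idea-16 (card `specialise-first-mu-x10b` v11 §14).
-/

set_option linter.dupNamespace false
set_option autoImplicit false

noncomputable section

namespace Summit.BirchSwinnertonDyer.BirchSwinnertonDyer.Theorems.PrintX9SharpMuSpecWitnessesAlong

/-- **Row-9 deciding crux from witnesses along an infinite set of levels**:
`HeegnerMuPartStabilized.SpecWitnessesCoherentPairAlong → PrintX9.HowardContainmentLightFramePinnedOfPrintSharp`
(the «along» shell ⟹ the L∃ letter, `muPartStabilizedCoherentPair_of_specWitnessesCoherentPairAlong`; the letter ⟹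
the crux, p631843). [cite: Howard2004HeegnerKolyvagin, proof of Thm. 2.2.10 (𝔮 = T^m + p)] -/
theorem howardContainmentLightFramePinnedOfPrintSharp_of_specWitnessesCoherentPairAlong
    (hW : HeegnerMuPartStabilized.SpecWitnessesCoherentPairAlong) :
    Summit.BirchSwinnertonDyer.BirchSwinnertonDyer.Theses.PrintX9.HowardContainmentLightFramePinnedOfPrintSharp :=
  PrintX9SharpMuCoherentPair.howardContainmentLightFramePinnedOfPrintSharp_of_muPartStabilizedCoherentPair
    (HeegnerMuPartStabilized.muPartStabilizedCoherentPair_of_specWitnessesCoherentPairAlong hW)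

/-- **The same from the tree's all-large-`m` shell** `HeegnerMuPartStabilized.SpecWitnessesCoherentPair` (p632362),
through the «along» weakening (kernel certificate that the two D1 targets are ordered and both close row 9).
[cite: Howard2004HeegnerKolyvagin, proof of Thm. 2.2.10 (𝔮 = T^m + p)] -/
theorem howardContainmentLightFramePinnedOfPrintSharp_of_specWitnessesCoherentPair
    (hW : HeegnerMuPartStabilized.SpecWitnessesCoherentPair) :
    Summit.BirchSwinnertonDyer.BirchSwinnertonDyer.Theses.PrintX9.HowardContainmentLightFramePinnedOfPrintSharp :=
  howardContainmentLightFramePinnedOfPrintSharp_of_specWitnessesCoherentPairAlong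
    (HeegnerMuPartStabilized.specWitnessesCoherentPairAlong_of_specWitnessesCoherentPair hW)

end Summit.BirchSwinnertonDyer.BirchSwinnertonDyer.Theorems.PrintX9SharpMuSpecWitnessesAlong

end
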